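import Mathlib
import Literature.Analysis.FluidPDE.VectorCalculus
import Literature.Analysis.FluidPDE.LeiZhang2011Proofs
import Summits.NavierStokesRegularity.NavierStokesRegularity.Theorems.FilamentSkeletonRssCoreGluingAccretionModeTools

/-!
# The MATCHED-CORE regularised Biot–Savart field of a proper filament: integrability and differentiability
# (variable core `m(u) ≥ m₀ > 0` along the filament)

Route `FilamentSkeletonRss`, A1G cone (cruxes `SkeletonJ1G` stmt-27849 / `TransverseReduction1AG` stmt-27853).  Since the
R-T/R-μ retype the skeleton's velocity field carries the MATCHED kernel
`((‖y − Z k σ‖² + e^{−(1+γ_E−log 2)}·Aa k σ)^{3/2})⁻¹` whose core scale VARIES along the filament with the transported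
core area `Aa k σ` — whereas the whole landed Biot–Savart toolkit (`SkeletonEquilibrium.Sketch.stub_kernelIntegrable`,
`stub_biotSavartDifferentiable`, `stub_biotSavartDirectionalDeriv`, and the 15 `SelectionBoxRJRung*` files of kit §5(d))
hard-wires a CONSTANT core `e²`.  This file is the first of the μ-parametrised restatements (kit
`Cruxes/SelectionBoxRJ/Lines/retype_R-T_kit.md` §5(d): «mechanical: 1 ↦ μ² with μ² ∈ [μ_min², μ_max²]»): for a core
PROFILE `m : ℝ → ℝ`, continuous with a floor `0 < m₀ ≤ m u` (in the crux: `m = κ·Aa k`, floor from `Λ⁻¹ ≤ Aa` of the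
near-straight regime / `0 < Aa` + continuity locally), and a `C¹` filament `X` with `‖X′‖ ≤ 1` and linear growth
`c|u| − C ≤ ‖X u‖`, the field

  `F(y) = ∫ ((‖y − X u‖² + m u)^{3/2})⁻¹ • X′(u) × (y − X u) du`

has a Bochner-integrable integrand at every point (`matchedBiotSavart_integrable`) and is Fréchet differentiable on `ℝ³`,
with derivative the integral of the `y`-derivative of the integrand (`matchedBiotSavart_hasFDerivAt`,
`matchedBiotSavart_differentiable`).  The pointwise kernel calculus is stated for an arbitrary constant `q > 0` in place
of `e²` (`kernel_hasFDerivAt`, `integrand_hasFDerivAt`, `norm_integrand_le`, `norm_fderiv_integrand_le`) and is public,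
for the sequel files (directional derivative, divergence-free trace, normal block); `y ↦ a × (y − b)` is the tree's
`…Theorems.hasFDerivAt_cross_sub_const` (CoreGluingAccretionModeTools).

Proof = the constant-core proofs of `…SkeletonEquilibriumBiotSavartDifferentiable.lean` (p132747) /
`…KernelIntegrable.lean` with `e² ↦ m u` pointwise and `e² ↦ m₀` in the dominations: on the ball `B(y₀, 1)`,
`(‖y − X u‖² + m u)⁻¹ ≤ (‖y − X u‖² + m₀)⁻¹ ≤ M (1 + u²)⁻¹`, `M = (4m₀ + c² + 4D²)/(c² m₀)`, `D = |C| + ‖y₀‖ + 1`; the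
integrand is `≤ σ⁻¹` and its `y`-derivative `≤ 4 m₀^{-1/2} σ⁻¹` (`σ = ‖y − X u‖² + m u`); joint continuity in `(u, y)`
uses `Continuous m`; Mathlib's `hasFDerivAt_integral_of_dominated_of_fderiv_le` and `measurable_fderiv_with_param`.
No upper bound on `m` is needed here.  Lane ns-filament-19175-p1 g11; `--supports stmt-NavierStokesRegularity-27849`.
HONEST FRAMING: calculus for a HYPOTHETICAL filament skeleton on the NEGATIVE side of a MODEL route; nothing here
bears on Navier–Stokes regularity or blow-up.
-/

noncomputable section

open MeasureTheory Filter Topology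
open Literature.Analysis.FluidPDE

namespace Summit.NavierStokesRegularity.NavierStokesRegularity.Theorems.MatchedKernel
set_option linter.dupNamespace false

/-! ### Pointwise kernel calculus with a positive core constant `q` -/

/-- The operator `a × ·` has norm at most `‖a‖`. [folklore] -/
theorem norm_crossCLM_le (a : EuclideanSpace ℝ (Fin 3)) : ‖crossCLM a‖ ≤ ‖a‖ :=
  ContinuousLinearMap.opNorm_le_bound _ (norm_nonneg a) fun b =>
    norm_cross_le_norm_mul_norm a b

/-- The regularised kernel `y ↦ ((‖y − b‖² + q)^{3/2})⁻¹` (`q > 0`) has derivative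
`−3 (‖y − b‖² + q)^{−5/2} ⟨y − b, ·⟩`. [folklore] -/
theorem kernel_hasFDerivAt {q : ℝ} (hq : 0 < q) (b y : EuclideanSpace ℝ (Fin 3)) :
    HasFDerivAt (fun y : EuclideanSpace ℝ (Fin 3) => ((‖y - b‖ ^ 2 + q) ^ (3 / 2 : ℝ))⁻¹)
      ((-3 * (‖y - b‖ ^ 2 + q) ^ (-(5 / 2) : ℝ)) • innerSL ℝ (y - b)) y := by
  have hpos : ∀ z : EuclideanSpace ℝ (Fin 3), 0 < ‖z - b‖ ^ 2 + q := fun z => by positivity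
  have h1 : HasFDerivAt (fun y : EuclideanSpace ℝ (Fin 3) => ‖y - b‖ ^ 2 + q)
      ((2 • innerSL ℝ (y - b)).comp (ContinuousLinearMap.id ℝ (EuclideanSpace ℝ (Fin 3)))) y :=
    ((hasStrictFDerivAt_norm_sq _).hasFDerivAt.comp y (hasFDerivAt_sub_const b)).add_const _
  have h2 := h1.rpow_const (p := -(3 / 2)) (Or.inl (hpos y).ne')
  have hfun : (fun y : EuclideanSpace ℝ (Fin 3) => ((‖y - b‖ ^ 2 + q) ^ (3 / 2 : ℝ))⁻¹)
      = fun y => (‖y - b‖ ^ 2 + q) ^ (-(3 / 2) : ℝ) := by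
    funext z
    rw [Real.rpow_neg (hpos z).le]
  rw [hfun]
  refine h2.congr_fderiv ?_
  rw [show (-(3 / 2) : ℝ) - 1 = -(5 / 2) by norm_num]
  ext h
  simp
  ring

/-- The `y`-derivative of the regularised Biot–Savart integrand `k_q(y − b) • a × (y − b)` (product rule). [folklore] -/
theorem integrand_hasFDerivAt {q : ℝ} (hq : 0 < q) (a b y : EuclideanSpace ℝ (Fin 3)) :
    HasFDerivAt (fun y : EuclideanSpace ℝ (Fin 3) => ((‖y - b‖ ^ 2 + q) ^ (3 / 2 : ℝ))⁻¹ • cross a (y - b))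
      (((‖y - b‖ ^ 2 + q) ^ (3 / 2 : ℝ))⁻¹ • crossCLM a +
        ((-3 * (‖y - b‖ ^ 2 + q) ^ (-(5 / 2) : ℝ)) • innerSL ℝ (y - b)).smulRight (cross a (y - b))) y :=
  (kernel_hasFDerivAt hq b y).smul (hasFDerivAt_cross_sub_const a b y)

/-- Scalar kernel estimate: `s^{−3/2} ≤ (√q)⁻¹ s⁻¹` for `s ≥ q > 0`. [folklore] -/
theorem rpow_neg_three_halves_le {q s : ℝ} (hq : 0 < q) (hs : q ≤ s) :
    s ^ (-(3 / 2) : ℝ) ≤ (Real.sqrt q)⁻¹ * s⁻¹ := by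
  have hs0 : 0 < s := hq.trans_le hs
  rw [show (-(3 / 2) : ℝ) = -(1 / 2) + -1 by norm_num, Real.rpow_add hs0, Real.rpow_neg_one]
  refine mul_le_mul_of_nonneg_right ?_ (inv_nonneg.2 hs0.le)
  calc s ^ (-(1 / 2) : ℝ) ≤ q ^ (-(1 / 2) : ℝ) := Real.rpow_le_rpow_of_nonpos hq hs (by norm_num)
    _ = (Real.sqrt q)⁻¹ := by rw [Real.rpow_neg hq.le, ← Real.sqrt_eq_rpow]

/-- Pointwise bound on the integrand: `‖k_q(v) • a × v‖ ≤ (‖v‖² + q)⁻¹` for `‖a‖ ≤ 1`, `q > 0`. [folklore] -/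
theorem norm_integrand_le {q : ℝ} (hq : 0 < q) (a v : EuclideanSpace ℝ (Fin 3)) (ha : ‖a‖ ≤ 1) :
    ‖((‖v‖ ^ 2 + q) ^ (3 / 2 : ℝ))⁻¹ • cross a v‖ ≤ (‖v‖ ^ 2 + q)⁻¹ := by
  have hs0 : 0 < ‖v‖ ^ 2 + q := by positivity
  have hv : ‖v‖ ≤ (‖v‖ ^ 2 + q) ^ (1 / 2 : ℝ) := by
    rw [← Real.sqrt_eq_rpow]
    exact Real.le_sqrt_of_sq_le (by nlinarith)
  rw [norm_smul, norm_inv, Real.norm_of_nonneg (Real.rpow_nonneg hs0.le _), ← Real.rpow_neg hs0.le]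
  calc (‖v‖ ^ 2 + q) ^ (-(3 / 2) : ℝ) * ‖cross a v‖
      ≤ (‖v‖ ^ 2 + q) ^ (-(3 / 2) : ℝ) * (‖v‖ ^ 2 + q) ^ (1 / 2 : ℝ) := by
        refine mul_le_mul_of_nonneg_left ?_ (Real.rpow_nonneg hs0.le _)
        calc ‖cross a v‖ ≤ ‖a‖ * ‖v‖ := norm_cross_le_norm_mul_norm a v
          _ ≤ 1 * ‖v‖ := mul_le_mul_of_nonneg_right ha (norm_nonneg _)
          _ ≤ _ := by rw [one_mul]; exact hv
    _ = (‖v‖ ^ 2 + q)⁻¹ := by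
        rw [← Real.rpow_add hs0, show (-(3 / 2) : ℝ) + 1 / 2 = -1 by norm_num, Real.rpow_neg_one]

/-- Operator-norm bound on the `y`-derivative of the integrand:
`‖k • (a × ·) + (−3 s^{−5/2} ⟨v, ·⟩) ⊗ (a × v)‖ ≤ 4 (√q)⁻¹ (‖v‖² + q)⁻¹` for `‖a‖ ≤ 1`, `q > 0`. [folklore] -/
theorem norm_fderiv_integrand_le {q : ℝ} (hq : 0 < q) (a v : EuclideanSpace ℝ (Fin 3)) (ha : ‖a‖ ≤ 1) :
    ‖((‖v‖ ^ 2 + q) ^ (3 / 2 : ℝ))⁻¹ • crossCLM a +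
        ((-3 * (‖v‖ ^ 2 + q) ^ (-(5 / 2) : ℝ)) • innerSL ℝ v).smulRight (cross a v)‖
      ≤ 4 * (Real.sqrt q)⁻¹ * (‖v‖ ^ 2 + q)⁻¹ := by
  set s := ‖v‖ ^ 2 + q with hs_def
  have hs0 : 0 < s := by positivity
  have hqs : q ≤ s := le_add_of_nonneg_left (sq_nonneg _)
  have hvs : ‖v‖ ^ 2 ≤ s := le_add_of_nonneg_right hq.le
  have hk : (s ^ (3 / 2 : ℝ))⁻¹ = s ^ (-(3 / 2) : ℝ) := (Real.rpow_neg hs0.le _).symm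
  have h1 : ‖(s ^ (3 / 2 : ℝ))⁻¹ • crossCLM a‖ ≤ s ^ (-(3 / 2) : ℝ) := by
    rw [norm_smul, hk, Real.norm_of_nonneg (Real.rpow_nonneg hs0.le _)]
    calc s ^ (-(3 / 2) : ℝ) * ‖crossCLM a‖ ≤ s ^ (-(3 / 2) : ℝ) * 1 :=
          mul_le_mul_of_nonneg_left ((norm_crossCLM_le a).trans ha) (Real.rpow_nonneg hs0.le _)
      _ = _ := mul_one _
  have h2 : ‖((-3 * s ^ (-(5 / 2) : ℝ)) • innerSL ℝ v).smulRight (cross a v)‖ ≤ 3 * s ^ (-(3 / 2) : ℝ) := by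
    rw [ContinuousLinearMap.norm_smulRight_apply, norm_smul, innerSL_apply_norm, Real.norm_eq_abs,
      abs_mul, abs_neg, abs_of_pos (by norm_num : (0 : ℝ) < 3), abs_of_nonneg (Real.rpow_nonneg hs0.le _)]
    calc 3 * s ^ (-(5 / 2) : ℝ) * ‖v‖ * ‖cross a v‖
        ≤ 3 * s ^ (-(5 / 2) : ℝ) * ‖v‖ * (1 * ‖v‖) := by
          refine mul_le_mul_of_nonneg_left ?_ (by positivity)
          exact (norm_cross_le_norm_mul_norm a v).trans
            (mul_le_mul_of_nonneg_right ha (norm_nonneg _))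
      _ = 3 * (s ^ (-(5 / 2) : ℝ) * ‖v‖ ^ 2) := by ring
      _ ≤ 3 * (s ^ (-(5 / 2) : ℝ) * s) := by gcongr
      _ = 3 * s ^ (-(3 / 2) : ℝ) := by
          rw [show (-(3 / 2) : ℝ) = -(5 / 2) + 1 by norm_num, Real.rpow_add_one hs0.ne']
  calc _ ≤ _ := norm_add_le _ _
    _ ≤ s ^ (-(3 / 2) : ℝ) + 3 * s ^ (-(3 / 2) : ℝ) := add_le_add h1 h2
    _ = 4 * s ^ (-(3 / 2) : ℝ) := by ring
    _ ≤ 4 * ((Real.sqrt q)⁻¹ * s⁻¹) := by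
        have := rpow_neg_three_halves_le hq hqs
        linarith
    _ = 4 * (Real.sqrt q)⁻¹ * s⁻¹ := (mul_assoc _ _ _).symm

/-! ### Dominations along a proper filament with a core floor `m₀` -/

/-- Far-field growth: if `c t − D ≤ r` (`c, D > 0`, `r, t ≥ 0`, `m₀ > 0`) then `1 + t² ≤ M (r² + m₀)` with
`M = (4m₀ + c² + 4D²)/(c² m₀)` (from `c² t² ≤ 4 r² + 4 D²`). [folklore] -/
theorem one_add_sq_le {c D r t m₀ : ℝ} (hc : 0 < c) (hD : 0 < D) (hr : 0 ≤ r) (ht : 0 ≤ t) (hm₀ : 0 < m₀)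
    (h : c * t - D ≤ r) : 1 + t ^ 2 ≤ (4 * m₀ + c ^ 2 + 4 * D ^ 2) / (c ^ 2 * m₀) * (r ^ 2 + m₀) := by
  have key : c ^ 2 * t ^ 2 ≤ 4 * r ^ 2 + 4 * D ^ 2 := by
    rcases le_or_gt (c * t) D with h1 | h1
    · have hct : 0 ≤ c * t := mul_nonneg hc.le ht
      nlinarith [mul_le_mul h1 h1 hct hD.le, sq_nonneg r]
    · have hctD : 0 ≤ c * t - D := by linarith
      nlinarith [mul_le_mul h h hctD hr, sq_nonneg (3 * c * t - 4 * D), sq_nonneg D]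
  have hc2 : 0 < c ^ 2 := by positivity
  rw [div_mul_eq_mul_div, le_div_iff₀ (by positivity)]
  nlinarith [mul_le_mul_of_nonneg_left key hm₀.le, mul_nonneg (sq_nonneg r) hm₀.le,
    mul_nonneg hc2.le (sq_nonneg r), mul_nonneg (sq_nonneg D) (sq_nonneg r), sq_nonneg m₀]

/-- Uniform domination on the unit ball around `y₀` with a core profile `m ≥ m₀ > 0`: for `y ∈ B(y₀, 1)`,
`(‖y − X u‖² + m u)⁻¹ ≤ M (1 + u²)⁻¹` with `M = (4m₀ + c² + 4D²)/(c² m₀)`, `D = |C| + ‖y₀‖ + 1`. [folklore] -/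
theorem inv_le_of_mem_ball {m : ℝ → ℝ} {m₀ c C : ℝ} {X : ℝ → EuclideanSpace ℝ (Fin 3)}
    (hm₀ : 0 < m₀) (hm : ∀ u, m₀ ≤ m u) (hc : 0 < c) (hXg : ∀ u, c * |u| - C ≤ ‖X u‖)
    (y₀ : EuclideanSpace ℝ (Fin 3)) {y : EuclideanSpace ℝ (Fin 3)} (hy : y ∈ Metric.ball y₀ 1) (u : ℝ) :
    (‖y - X u‖ ^ 2 + m u)⁻¹ ≤ (4 * m₀ + c ^ 2 + 4 * (|C| + ‖y₀‖ + 1) ^ 2) / (c ^ 2 * m₀) * (1 + u ^ 2)⁻¹ := by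
  have hD : 0 < |C| + ‖y₀‖ + 1 := by positivity
  have hy' : ‖y - y₀‖ < 1 := mem_ball_iff_norm.1 hy
  have hr : c * |u| - (|C| + ‖y₀‖ + 1) ≤ ‖y - X u‖ := by
    have h1 := norm_sub_norm_le (X u) y
    have h2 := norm_le_norm_add_norm_sub' y y₀
    have h3 := hXg u
    have h4 := le_abs_self C
    rw [norm_sub_rev] at h1
    linarith
  have key := one_add_sq_le hc hD (norm_nonneg _) (abs_nonneg u) hm₀ hr
  rw [sq_abs] at key
  have hs1 : 0 < ‖y - X u‖ ^ 2 + m₀ := by positivity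
  have hmono : (‖y - X u‖ ^ 2 + m u)⁻¹ ≤ (‖y - X u‖ ^ 2 + m₀)⁻¹ :=
    inv_anti₀ hs1 (by linarith [hm u])
  refine hmono.trans ?_
  have h1u : 0 < 1 + u ^ 2 := by positivity
  rw [← div_eq_mul_inv, le_div_iff₀ h1u, inv_mul_le_iff₀ hs1]
  linarith [mul_comm ((4 * m₀ + c ^ 2 + 4 * (|C| + ‖y₀‖ + 1) ^ 2) / (c ^ 2 * m₀)) (‖y - X u‖ ^ 2 + m₀)]

/-- Joint continuity of the matched-core integrand in `(u, y)` (needs the core profile `m` continuous and positive).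
[folklore] -/
theorem continuous_integrand {m : ℝ → ℝ} {m₀ : ℝ} (hm₀ : 0 < m₀) (hm : ∀ u, m₀ ≤ m u) (hmc : Continuous m)
    {X : ℝ → EuclideanSpace ℝ (Fin 3)} (hX : ContDiff ℝ 1 X) :
    Continuous (fun p : ℝ × EuclideanSpace ℝ (Fin 3) =>
      ((‖p.2 - X p.1‖ ^ 2 + m p.1) ^ (3 / 2 : ℝ))⁻¹ • cross (deriv X p.1) (p.2 - X p.1)) := by
  have hXc : Continuous X := hX.continuous
  have hX'c : Continuous (deriv X) := hX.continuous_deriv le_rfl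
  have hv : Continuous (fun p : ℝ × EuclideanSpace ℝ (Fin 3) => p.2 - X p.1) :=
    continuous_snd.sub (hXc.comp continuous_fst)
  have hcr : Continuous (fun p : ℝ × EuclideanSpace ℝ (Fin 3) => cross (deriv X p.1) (p.2 - X p.1)) :=
    (crossCLM.continuous.comp (hX'c.comp continuous_fst)).clm_apply hv
  have hk : Continuous (fun p : ℝ × EuclideanSpace ℝ (Fin 3) => ((‖p.2 - X p.1‖ ^ 2 + m p.1) ^ (3 / 2 : ℝ))⁻¹) := by
    refine (((hv.norm.pow 2).add (hmc.comp continuous_fst)).rpow_const fun p => Or.inr (by norm_num)).inv₀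
      fun p => ?_
    have : 0 < ‖p.2 - X p.1‖ ^ 2 + m p.1 :=
      add_pos_of_nonneg_of_pos (sq_nonneg _) (hm₀.trans_le (hm p.1))
    exact (Real.rpow_pos_of_pos this _).ne'
  exact hk.smul hcr

/-- **Integrability** of the matched-core Biot–Savart integrand at every point: `m` continuous with a floor
`0 < m₀ ≤ m u`, `X` a `C¹` proper filament (`‖X′‖ ≤ 1`, `c|u| − C ≤ ‖X u‖`, `c > 0`). [folklore] -/
theorem matchedBiotSavart_integrable {m : ℝ → ℝ} {m₀ c C : ℝ} {X : ℝ → EuclideanSpace ℝ (Fin 3)}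
    (hm₀ : 0 < m₀) (hm : ∀ u, m₀ ≤ m u) (hmc : Continuous m) (hc : 0 < c) (hX : ContDiff ℝ 1 X)
    (hX1 : ∀ u, ‖deriv X u‖ ≤ 1) (hXg : ∀ u, c * |u| - C ≤ ‖X u‖) (y : EuclideanSpace ℝ (Fin 3)) :
    Integrable (fun u : ℝ => ((‖y - X u‖ ^ 2 + m u) ^ (3 / 2 : ℝ))⁻¹ • cross (deriv X u) (y - X u)) := by
  have hcont := (continuous_integrand hm₀ hm hmc hX).curry_left (y := y)
  refine (integrable_inv_one_add_sq.const_mul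
    ((4 * m₀ + c ^ 2 + 4 * (|C| + ‖y‖ + 1) ^ 2) / (c ^ 2 * m₀))).mono' hcont.aestronglyMeasurable
    (Eventually.of_forall fun u => ?_)
  have hq : 0 < m u := hm₀.trans_le (hm u)
  exact (norm_integrand_le hq _ _ (hX1 u)).trans (inv_le_of_mem_ball hm₀ hm hc hXg y (Metric.mem_ball_self one_pos) u)

/-- **Differentiation under the integral sign at a point `y₀`**: the matched-core Biot–Savart field has Fréchet
derivative `∫ ∂_y F(y₀, u) du` at `y₀`. [folklore] -/
theorem matchedBiotSavart_hasFDerivAt {m : ℝ → ℝ} {m₀ c C : ℝ} {X : ℝ → EuclideanSpace ℝ (Fin 3)}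
    (hm₀ : 0 < m₀) (hm : ∀ u, m₀ ≤ m u) (hmc : Continuous m) (hc : 0 < c) (hX : ContDiff ℝ 1 X)
    (hX1 : ∀ u, ‖deriv X u‖ ≤ 1) (hXg : ∀ u, c * |u| - C ≤ ‖X u‖) (y₀ : EuclideanSpace ℝ (Fin 3)) :
    HasFDerivAt (fun y : EuclideanSpace ℝ (Fin 3) => ∫ u : ℝ,
        ((‖y - X u‖ ^ 2 + m u) ^ (3 / 2 : ℝ))⁻¹ • cross (deriv X u) (y - X u))
      (∫ u : ℝ, fderiv ℝ (fun y : EuclideanSpace ℝ (Fin 3) =>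
        ((‖y - X u‖ ^ 2 + m u) ^ (3 / 2 : ℝ))⁻¹ • cross (deriv X u) (y - X u)) y₀) y₀ := by
  set M : ℝ := (4 * m₀ + c ^ 2 + 4 * (|C| + ‖y₀‖ + 1) ^ 2) / (c ^ 2 * m₀) with hM_def
  have hcont := continuous_integrand hm₀ hm hmc hX
  have hFy : ∀ y : EuclideanSpace ℝ (Fin 3), Continuous (fun u : ℝ =>
      ((‖y - X u‖ ^ 2 + m u) ^ (3 / 2 : ℝ))⁻¹ • cross (deriv X u) (y - X u)) :=
    fun y => hcont.curry_left (y := y)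
  have hdom : ∀ u : ℝ, ∀ y ∈ Metric.ball y₀ 1, (‖y - X u‖ ^ 2 + m u)⁻¹ ≤ M * (1 + u ^ 2)⁻¹ :=
    fun u y hy => inv_le_of_mem_ball hm₀ hm hc hXg y₀ hy u
  have hq : ∀ u, 0 < m u := fun u => hm₀.trans_le (hm u)
  have hsqrt : ∀ u, (Real.sqrt (m u))⁻¹ ≤ (Real.sqrt m₀)⁻¹ := fun u =>
    inv_anti₀ (Real.sqrt_pos.2 hm₀) (Real.sqrt_le_sqrt (hm u))
  refine hasFDerivAt_integral_of_dominated_of_fderiv_le (𝕜 := ℝ) (μ := volume) (x₀ := y₀)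
    (F := fun (y : EuclideanSpace ℝ (Fin 3)) (u : ℝ) =>
      ((‖y - X u‖ ^ 2 + m u) ^ (3 / 2 : ℝ))⁻¹ • cross (deriv X u) (y - X u))
    (F' := fun (y : EuclideanSpace ℝ (Fin 3)) (u : ℝ) =>
      fderiv ℝ (fun y : EuclideanSpace ℝ (Fin 3) =>
        ((‖y - X u‖ ^ 2 + m u) ^ (3 / 2 : ℝ))⁻¹ • cross (deriv X u) (y - X u)) y)
    (bound := fun u => 4 * (Real.sqrt m₀)⁻¹ * (M * (1 + u ^ 2)⁻¹))
    (Metric.ball_mem_nhds y₀ one_pos) ?_ ?_ ?_ ?_ ?_ ?_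
  · exact Eventually.of_forall fun y => (hFy y).aestronglyMeasurable
  · refine (integrable_inv_one_add_sq.const_mul M).mono' (hFy y₀).aestronglyMeasurable
      (Eventually.of_forall fun u => ?_)
    exact (norm_integrand_le (hq u) _ _ (hX1 u)).trans (hdom u y₀ (Metric.mem_ball_self one_pos))
  · have hmeas := measurable_fderiv_with_param ℝ
      (f := fun (u : ℝ) (y : EuclideanSpace ℝ (Fin 3)) =>
        ((‖y - X u‖ ^ 2 + m u) ^ (3 / 2 : ℝ))⁻¹ • cross (deriv X u) (y - X u)) hcont
    exact (hmeas.comp measurable_prodMk_right).aestronglyMeasurable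
  · refine Eventually.of_forall fun u y hy => ?_
    rw [(integrand_hasFDerivAt (hq u) (deriv X u) (X u) y).fderiv]
    calc _ ≤ 4 * (Real.sqrt (m u))⁻¹ * (‖y - X u‖ ^ 2 + m u)⁻¹ := norm_fderiv_integrand_le (hq u) _ _ (hX1 u)
      _ ≤ 4 * (Real.sqrt m₀)⁻¹ * (M * (1 + u ^ 2)⁻¹) := by
          have h1 := hsqrt u
          have h2 := hdom u y hy
          have h3 : 0 ≤ (‖y - X u‖ ^ 2 + m u)⁻¹ := inv_nonneg.2 (add_pos_of_nonneg_of_pos (sq_nonneg _) (hq u)).le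
          have h4 : 0 ≤ (Real.sqrt m₀)⁻¹ := inv_nonneg.2 (Real.sqrt_nonneg _)
          calc 4 * (Real.sqrt (m u))⁻¹ * (‖y - X u‖ ^ 2 + m u)⁻¹
              ≤ 4 * (Real.sqrt m₀)⁻¹ * (‖y - X u‖ ^ 2 + m u)⁻¹ := by gcongr
            _ ≤ 4 * (Real.sqrt m₀)⁻¹ * (M * (1 + u ^ 2)⁻¹) := mul_le_mul_of_nonneg_left h2 (by positivity)
  · exact (integrable_inv_one_add_sq.const_mul M).const_mul _
  · exact Eventually.of_forall fun u y _ =>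
      (integrand_hasFDerivAt (hq u) (deriv X u) (X u) y).differentiableAt.hasFDerivAt

/-- **The matched-core Biot–Savart field is differentiable on `ℝ³`.** [folklore] -/
theorem matchedBiotSavart_differentiable {m : ℝ → ℝ} {m₀ c C : ℝ} {X : ℝ → EuclideanSpace ℝ (Fin 3)}
    (hm₀ : 0 < m₀) (hm : ∀ u, m₀ ≤ m u) (hmc : Continuous m) (hc : 0 < c) (hX : ContDiff ℝ 1 X)
    (hX1 : ∀ u, ‖deriv X u‖ ≤ 1) (hXg : ∀ u, c * |u| - C ≤ ‖X u‖) :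
    Differentiable ℝ (fun y : EuclideanSpace ℝ (Fin 3) => ∫ u : ℝ,
        ((‖y - X u‖ ^ 2 + m u) ^ (3 / 2 : ℝ))⁻¹ • cross (deriv X u) (y - X u)) :=
  fun y₀ => (matchedBiotSavart_hasFDerivAt hm₀ hm hmc hc hX hX1 hXg y₀).differentiableAt

end Summit.NavierStokesRegularity.NavierStokesRegularity.Theorems.MatchedKernel
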